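import Mathlib
import HarnessLib
import Literature.Analysis.FluidPDE.SelfSimilar
import Literature.Analysis.FluidPDE.TypeIAncientMild
import Summits.NavierStokesRegularity.NavierStokesRegularity.Theses.QuarterLogPincer
import Summits.NavierStokesRegularity.NavierStokesRegularity.Theorems.QuarterLogPincerThinCascadeDefs
import Summits.NavierStokesRegularity.NavierStokesRegularity.Theorems.QuarterLogPincerTruncationEdgeDefs

/-!
# Route `QuarterLogPincer` — objects posited by the LOOP line `quiet_collar` of crux `TypeIQuantSubcubicExp`
  (stmt-NavierStokesRegularity-24077): the log-cube class and its Liouville values, the obligations Q1/Q2/Q3, and the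
  Q1 ANATOMY (v1.1) — QP1 `QuietCollar`, QP2 `CutPair`, QP3 `ForcedTwoNormShadowing` — with their closed `Stub…` forms

Definitions ONLY — the line objects of `Cruxes/TypeIQuantSubcubicExp/Lines/quiet_collar.lean` (author of every statement:
**ns-idea-7 g9**; version of record v1.1, tree sha16 `8170489f8bcaaff9`, critic of record idea-crit-4 g6: v1.0 PASS, no price,
2026-08-28T22:42:30Z), copied VERBATIM and only re-homed into an importable module (crux workfiles under `Cruxes/` are not
importable from `Theorems/`), exactly as `QuarterLogPincerTruncationEdgeDefs` / `QuarterLogPincerTruncationEdgeAnatomyDefs`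
serve the line `truncation_edge`.  Same namespace as the line (`…Cruxes.TypeIQuantSubcubicExp.QuietCollar`), same names, same
bodies, so that the obligations can be discharged BY NAME in separate Theorems files (first: QP1 `stub_quietCollar`,
`Theorems/QuarterLogPincerQuietCollarLever.lean`, DIRECTOR-NS dss_121).  Re-homed by the pub-ns-dss typer (g36).

* the log-cube class values `LocalRateFloor`, `LogCubeLiouville`, `LogCubeFloorLiouville`;
* the obligations Q1 `StubQuietTruncation` (load-bearing; DERIVED in the line from QP1–QP3 + the landed P2), Q3
  `StubLocalRateFloor` (optional value upgrade), Q2 `StubLogCubeExtraction` (converse direction only);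
* the Q1 anatomy: `mildDefect`, QP1 `QuietCollar`, QP2 `CutPair`, QP3 `ForcedTwoNormShadowing`, and the closed forms
  `StubQuietCollar`, `StubCutPair`, `StubForcedTwoNormShadowing`.

The line's THEOREMS (the family `truncatedFamily_of_localFloor`, the edge / converse / loop, `farFieldTruncation_of_quietAnatomy`,
the rungs) are NOT in this file.

HONEST FRAME: a LOOP (calibration) line — modulo Q1 (edge) and Q2 (converse) it identifies the crux 24077 with the log-cube floor
Liouville statement; it does not attack the DSS wall.  Nothing in this file is asserted: objects only.  QP1–QP3, Q2, Q3, 24077,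
22144, the DSS wall W7 and Navier–Stokes regularity are OPEN / not proved.
-/

noncomputable section

-- the summit-side namespace repeats a component by design (D-0017)
set_option linter.dupNamespace false

namespace Summit.NavierStokesRegularity.NavierStokesRegularity.Cruxes.TypeIQuantSubcubicExp.QuietCollar

open MeasureTheory Set Function Metric Filter Topology
open scoped ENNReal NNReal
open Literature.Analysis Literature.Analysis.FluidPDE
open Summit.NavierStokesRegularity.NavierStokesRegularity.Cruxes.TypeIQuantSubcubicExp.ThinCascade
  (TaoFrame SingularAt)
open Summit.NavierStokesRegularity.NavierStokesRegularity.Cruxes.TypeIQuantSubcubicExp.TruncationEdge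
  (FarFieldTruncation EnvelopeCubeBudget)

/-! ### Objects (verbatim from `Lines/quiet_collar.lean` v1.1) -/

/-! ### The log-cube class, the localised floor, the Liouville value -/

/-- **LOCALISED LERAY FLOOR near the apex**: some `c > 0` and `s₀ < 0` such that for every
`s ∈ [s₀, 0)` the Type-I floor `c/√(−s)` is attained at a point of the UNIT BALL.  (For an enveloped field
this follows from the landed global floor T4 — `localRateFloor_of_hasTypeIDecay` below; in general it is Q3.)
[line object of `Cruxes/TypeIQuantSubcubicExp/Lines/quiet_collar.lean` v1.1 (ns-idea-7 g9), verbatim] -/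
def LocalRateFloor (v : ℝ → EuclideanSpace ℝ (Fin 3) → EuclideanSpace ℝ (Fin 3)) : Prop :=
  ∃ c s₀ : ℝ, 0 < c ∧ s₀ < 0 ∧ ∀ s ∈ Set.Ico s₀ 0,
    ∃ x ∈ Metric.ball (0 : EuclideanSpace ℝ (Fin 3)) 1, c / Real.sqrt (-s) ≤ ‖v s x‖

/-- **LOG-CUBE LIOUVILLE**: no Type-I ancient mild field (KNSS gauge, `IsTypeIAncientMild M v`) whose
localised slices obey the LOG-SHAPED CUBE BUDGET (`EnvelopeCubeBudget v`, T3's conclusion BY NAME: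
`‖1_{B(R)} v(s)‖₃³ ≤ B(1 + log R + log(1/ε))` for `s ∈ [−1,−ε]`, NO pointwise decay) is singular at the apex.
Contains the envelope-class Liouville statement (`envelopeLiouville_of_logCubeLiouville`, via the landed T3)
and is refuted by any Type-I backward-`λ`-DSS profile. [line object of `Cruxes/TypeIQuantSubcubicExp/Lines/quiet_collar.lean` v1.1 (ns-idea-7 g9),
verbatim — the candidate EXACT VALUE of the crux] -/
def LogCubeLiouville : Prop :=
  ∀ (M : ℝ) (v : ℝ → EuclideanSpace ℝ (Fin 3) → EuclideanSpace ℝ (Fin 3)),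
    IsTypeIAncientMild M v → EnvelopeCubeBudget v → ¬ SingularAt v 0

/-- **LOG-CUBE FLOOR LIOUVILLE**: no Type-I ancient mild field with the log-shaped cube budget carries a
LOCALISED LERAY FLOOR (`LocalRateFloor v`: the rate `c/√(−s)` realised inside the unit ball for all `s` near
the apex — a rate-carrying singularity in `B̄(0,1)`; every enveloped field singular at the apex carries one,
`localRateFloor_of_hasTypeIDecay`, and so does every Type-I backward-`λ`-DSS profile).  THIS is the value the
crux reaches with the single input Q1 (`logCubeFloorLiouville_of_typeIQuantSubcubicExp`); with Q3 it upgrades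
to `LogCubeLiouville`. [line object of `Cruxes/TypeIQuantSubcubicExp/Lines/quiet_collar.lean` v1.1
(ns-idea-7 g9), verbatim — the EXACT VALUE of the crux modulo Q1 (edge) and Q2 (converse)] -/
def LogCubeFloorLiouville : Prop :=
  ∀ (M : ℝ) (v : ℝ → EuclideanSpace ℝ (Fin 3) → EuclideanSpace ℝ (Fin 3)),
    IsTypeIAncientMild M v → EnvelopeCubeBudget v → ¬ LocalRateFloor v

/-- (Q1) **QUIET-COLLAR TRUNCATION STABILITY** (LOAD-BEARING; the single new input): T1's conclusion
`FarFieldTruncation M' v` (BY NAME, the object of `Theorems/QuarterLogPincerTruncationEdgeDefs.lean`) at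
SOME virtual rate constant `M'` (the arithmetic core accepts any; a contaminated collar may cost `M' > M`) for
every Type-I ancient mild field carrying only the log-shaped cube budget — the ENVELOPE-FREE far-field
truncation. [line object of `Cruxes/TypeIQuantSubcubicExp/Lines/quiet_collar.lean` v1.1 (ns-idea-7 g9), verbatim] -/
def StubQuietTruncation : Prop :=
  ∀ (M : ℝ) (v : ℝ → EuclideanSpace ℝ (Fin 3) → EuclideanSpace ℝ (Fin 3)),
    IsTypeIAncientMild M v → EnvelopeCubeBudget v → ∃ M' : ℝ, FarFieldTruncation M' v

/-- (Q3) **LOCALISED LERAY FLOOR** for singular Type-I ancient mild fields (NOT needed by the loop; it only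
upgrades the value `LogCubeFloorLiouville` to `LogCubeLiouville`): the floor point of the landed T4
(`stub_rateFloor`: `sup_x ‖v(s,x)‖ ≥ c/√(−s)`) can be taken in the unit ball for `s` near the apex.  PROVED for
enveloped fields (`localRateFloor_of_hasTypeIDecay`).  Nearest print: `L³` concentration at the similarity
scale (Barker–Prange 2020 Thm 2; tree `Literature…BarkerPrange2020_thm2_holds`, Leray–Hopf + MORREY Type-I —
which a log-cube field satisfies only up to `(log(1/(−s)))^{1/3}`).  Why it might fail: a FLICKERING core
(quiet relative to the rate at a sequence of times while far bumps carry Leray's floor) is not excluded for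
infinite-energy Type-I ancient fields — cf. the tree's `PerpetualFlickerLiouville` (24374) /
`AsymmetricFlickerLiouville` (24453), both consequences of 24077. [line object of `Cruxes/TypeIQuantSubcubicExp/Lines/quiet_collar.lean` v1.1 (ns-idea-7 g9), verbatim] -/
def StubLocalRateFloor : Prop :=
  ∀ (M : ℝ) (v : ℝ → EuclideanSpace ℝ (Fin 3) → EuclideanSpace ℝ (Fin 3)),
    IsTypeIAncientMild M v → SingularAt v 0 → LocalRateFloor v

/-- (Q2) **LOG-CUBE EXTRACTION WITH A FLOOR** (converse direction ONLY): if the crux fails, some Type-I ancient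
mild field with the log-shaped cube budget carries a localised Leray floor (upgrade of `ab_root`'s
`exists_thin_singular_abTower_of_not_typeIQuantSubcubicExp`: all-time ball budgets by a rising-sun selection of
the cheap cascade's scales before the KNSS limit + lower semicontinuity; the floor by CENTRING each zoom on a
rate-carrying point `|u(t, x(t))| ≥ c/√(T−t)` (Leray) and local uniform convergence on the open past — why it
might fail: the floor points of the blow-up sequence may wander off at the zoom scale (flicker between nascent
singularities), leaving only `SingularAt`, i.e. Q3's gap on the other side). [line object of `Cruxes/TypeIQuantSubcubicExp/Lines/quiet_collar.lean` v1.1 (ns-idea-7 g9), verbatim] -/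
def StubLogCubeExtraction : Prop :=
  ¬ Summit.NavierStokesRegularity.NavierStokesRegularity.Theses.QuarterLogPincer.TypeIQuantSubcubicExp →
    ∃ (M : ℝ) (v : ℝ → EuclideanSpace ℝ (Fin 3) → EuclideanSpace ℝ (Fin 3)),
      IsTypeIAncientMild M v ∧ EnvelopeCubeBudget v ∧ LocalRateFloor v

/-- The MILD DEFECT of a reference field `V` on `[0,t]`: `V(t) − e^{tΔ}V(0) + B₀(V,V)(t)` (zero iff `V` is an
Oseen-mild solution from time `0`; tree operators `heatFlow`, `oseenDuhamel` at unit viscosity). [line object of `Cruxes/TypeIQuantSubcubicExp/Lines/quiet_collar.lean` v1.1 (ns-idea-7 g9), verbatim] -/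
def mildDefect (V : ℝ → EuclideanSpace ℝ (Fin 3) → EuclideanSpace ℝ (Fin 3)) (t : ℝ)
    (x : EuclideanSpace ℝ (Fin 3)) : EuclideanSpace ℝ (Fin 3) :=
  V t x - heatFlow (V 0) t x + oseenDuhamel 1 0 V V t x

/-- (QP1) **QUIET COLLAR** (Type-I rate + log-cube budget; no envelope): for any polynomial request
(quietness `ηq ≥ ε^k/K`, width `Lq ≤ K ε^{-k}`) there is, at a POLYNOMIAL radius `r + Lq ≤ K₁ ε^{-κ₁}`, a collar
`{r ≤ |x| ≤ r + Lq}` on which `|v(s,x)| ≤ ηq` for ALL `s ∈ [−1,−ε]`.  Road (spike counting, Chebyshev–Fubini):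
a point with `|v(s,x)| > ηq` carries a forward parabolic neighbourhood of `L³`-mass `≳ ηq⁷ ε^{9/2}/C_M⁴` (Type-I
gradient / time-derivative bounds `|∇v| ≲ C_M/(−s)`, `|∂_s v| ≲ C_M (−s)^{-3/2}`); the radial shadows (width
`2Lq`) of all such neighbourhoods have total length `≲ Lq · B(1 + log(3ρ) + log(2/ε)) · C_M⁴ ηq^{-7} ε^{-9/2} < ρ`
for `ρ` polynomially large, so some `r ∈ [ρ, 2ρ]` is shadow-free. [line object of `Cruxes/TypeIQuantSubcubicExp/Lines/quiet_collar.lean` v1.1 (ns-idea-7 g9), verbatim] -/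
def QuietCollar (v : ℝ → EuclideanSpace ℝ (Fin 3) → EuclideanSpace ℝ (Fin 3)) : Prop :=
  ∀ k K : ℝ, 0 ≤ k → 1 ≤ K → ∃ κ₁ K₁ : ℝ, 0 ≤ κ₁ ∧ 2 ≤ K₁ ∧
    ∀ ε ∈ Set.Ioc (0 : ℝ) (1 / 2), ∀ ηq Lq : ℝ, ε ^ k / K ≤ ηq → 0 < Lq → Lq ≤ K * ε ^ (-k) →
      ∃ r : ℝ, 2 ≤ r ∧ r + Lq ≤ K₁ * ε ^ (-κ₁) ∧
        ∀ s ∈ Set.Icc (-1 : ℝ) (-ε), ∀ x : EuclideanSpace ℝ (Fin 3),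
          r ≤ ‖x‖ → ‖x‖ ≤ r + Lq → ‖v s x‖ ≤ ηq

/-- (QP2) **CUT PAIR** (NS-generic given rate + budget + a quiet collar): with a radial cut-off `χ` (`= 1` on
`B(r)`, transition inside the quiet collar, `|∇χ| ≲ 1/L`, `L` polynomially large) the REFERENCE `V(t) = χ v(t−1)`
and the DATUM `u₀ =` (Leray projection `P(χ v(−1)) = χv(−1) − ∇Δ⁻¹(∇χ·v(−1))`, truncated far out at a dyadic
shell `[R′,2R′]` with a Bogovskiĭ corrector — smooth, divergence-free, compactly supported) satisfy: `u₀` is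
`η₁εⁿ`-close to `V(0)` in SUP (`|∇Δ⁻¹(∇χ·v)| ≲ ηq log(r/ηq)`), `O(b)`-close in `L³` (Riesz transforms on
`L³(ℝ³)`: `‖∇Δ⁻¹div(χv)‖₃ ≤ C‖χv‖₃` — the honest size: a coherent flux through the collar costs interior
`L³`-mass); `V` is continuous, dominated by `|v(·−1)|`, vanishes beyond `R`, equals `v(·−1)` on `B(r)`, has
`L³`-norm at most that of `1_{B(0,R)} v(·−1)`; and its MILD DEFECT is `η₁εⁿ`-small in sup and `O(b)` in `L³`
(commutators `[χ, e^{tΔ}]`, `[χ, e^{τΔ}P∇·]` with kernels `G_t(z) min(1,|z|/L)`, `(|z|+√τ)^{-4} min(1,|z|/L)` of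
`L¹`-size `√t/L`, `log(L/√τ)/L`; the `(χ²−χ) v⊗v` term by the collar's quietness; far shells by the budget).
The requests `ηq ≥ ε^{k₂}/K₂`, `Lq ≤ K₂ε^{-k₂}` are polynomial and `R ≤ K₂ ε^{-k₂} r²`. [line object of `Cruxes/TypeIQuantSubcubicExp/Lines/quiet_collar.lean` v1.1 (ns-idea-7 g9), verbatim] -/
def CutPair (v : ℝ → EuclideanSpace ℝ (Fin 3) → EuclideanSpace ℝ (Fin 3)) : Prop :=
  ∀ η₁ n : ℝ, 0 < η₁ → 0 ≤ n → ∃ k₂ K₂ : ℝ, 0 ≤ k₂ ∧ 1 ≤ K₂ ∧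
    ∀ ε ∈ Set.Ioc (0 : ℝ) (1 / 2), ∃ ηq Lq : ℝ, ε ^ k₂ / K₂ ≤ ηq ∧ 0 < Lq ∧ Lq ≤ K₂ * ε ^ (-k₂) ∧
      ∀ r : ℝ, 2 ≤ r →
        (∀ s ∈ Set.Icc (-1 : ℝ) (-ε), ∀ x : EuclideanSpace ℝ (Fin 3),
            r ≤ ‖x‖ → ‖x‖ ≤ r + Lq → ‖v s x‖ ≤ ηq) →
        ∃ (R : ℝ) (V : ℝ → EuclideanSpace ℝ (Fin 3) → EuclideanSpace ℝ (Fin 3))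
          (u₀ : EuclideanSpace ℝ (Fin 3) → EuclideanSpace ℝ (Fin 3)),
          r + Lq ≤ R ∧ R ≤ K₂ * ε ^ (-k₂) * (r * r) ∧
          ContDiff ℝ (⊤ : ℕ∞) u₀ ∧ VectorCalculus.IsDivFree u₀ ∧ HasCompactSupport u₀ ∧
          (∀ x, ‖u₀ x - V 0 x‖ ≤ η₁ * ε ^ n) ∧
          ContinuousOn (uncurry V) (Set.Icc 0 (1 - ε) ×ˢ Set.univ) ∧
          (∀ t ∈ Set.Icc 0 (1 - ε), ∀ x, ‖V t x‖ ≤ ‖v (t - 1) x‖) ∧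
          (∀ t ∈ Set.Icc 0 (1 - ε), ∀ x : EuclideanSpace ℝ (Fin 3), R ≤ ‖x‖ → V t x = 0) ∧
          (∀ t ∈ Set.Icc 0 (1 - ε), ∀ x : EuclideanSpace ℝ (Fin 3), ‖x‖ ≤ r → V t x = v (t - 1) x) ∧
          (∀ t ∈ Set.Icc 0 (1 - ε), eLpNorm (V t) 3 volume ≤
              eLpNorm ((Metric.ball (0 : EuclideanSpace ℝ (Fin 3)) R).indicator (v (t - 1))) 3 volume) ∧
          (∀ t ∈ Set.Icc 0 (1 - ε), ∀ x, ‖mildDefect V t x‖ ≤ η₁ * ε ^ n) ∧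
          (∀ b : ℝ, 0 ≤ b →
            (∀ s ∈ Set.Icc (-1 : ℝ) (-ε),
                eLpNorm ((Metric.ball (0 : EuclideanSpace ℝ (Fin 3)) R).indicator (v s)) 3 volume ≤
                  ENNReal.ofReal b) →
            eLpNorm (fun x => u₀ x - V 0 x) 3 volume ≤ ENNReal.ofReal (K₂ * (b + 1)) ∧
            ∀ t ∈ Set.Icc 0 (1 - ε), eLpNorm (mildDefect V t) 3 volume ≤ ENNReal.ofReal (K₂ * (b + 1)))

/-- (QP3) **FORCED TWO-NORM SHADOWING WITH POLYNOMIAL LOSS** (Type-I RATE only — no `v`, no budget, no envelope: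
pure NS perturbation theory around a rate-`M` reference with a mild defect).  SUP part = P3a of `truncation_edge`
with a defect term: the Henry–Gronwall kernel `C(t−σ)^{-1/2}(M(1−σ)^{-1/2} + 2)` across `log₂(1/ε)` dyadic blocks
turns sup-data-error + sup-defect `η` into `K ε^{-κ} η`.  `L³` part = LOSSLESS once `K ε^{-κ} η ≤ 1`: in
`w = e^{tΔ}w₀ − B₀(w,u) − B₀(V,w) − D` estimate the bilinear terms by `‖w‖_∞ (‖u‖₃ + ‖V‖₃)` (Young,
`‖∇O_τ‖_{L¹} ≲ τ^{-1/2}`), so the `L³` coefficient is the SMALL number `K ε^{-κ} η` and `O(b)`-sized `L³` data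
error / defect are NOT amplified: `‖w‖₃ ≤ K(β + b · Kε^{-κ}η)`. [line object of `Cruxes/TypeIQuantSubcubicExp/Lines/quiet_collar.lean` v1.1 (ns-idea-7 g9), verbatim] -/
def ForcedTwoNormShadowing : Prop :=
  ∀ M : ℝ, 0 ≤ M → ∃ κ K : ℝ, 0 ≤ κ ∧ 1 ≤ K ∧ ∀ ε ∈ Set.Ioc (0 : ℝ) (1 / 2), ∀ η : ℝ, 0 ≤ η →
    ∀ (V : ℝ → EuclideanSpace ℝ (Fin 3) → EuclideanSpace ℝ (Fin 3)),
      ContinuousOn (uncurry V) (Set.Icc 0 (1 - ε) ×ˢ Set.univ) →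
      (∀ t ∈ Set.Icc 0 (1 - ε), ∀ x, ‖V t x‖ ≤ M * (1 - t) ^ (-(1 / 2 : ℝ))) →
      (∃ R : ℝ, ∀ t ∈ Set.Icc 0 (1 - ε), ∀ x : EuclideanSpace ℝ (Fin 3), R ≤ ‖x‖ → V t x = 0) →
      (∀ t ∈ Set.Icc 0 (1 - ε), ∀ x, ‖mildDefect V t x‖ ≤ η) →
    ∀ u₀ : EuclideanSpace ℝ (Fin 3) → EuclideanSpace ℝ (Fin 3), (∀ x, ‖u₀ x - V 0 x‖ ≤ η) →
    ∀ T' ∈ Set.Ioc (0 : ℝ) (1 - ε),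
    ∀ (u : ℝ → EuclideanSpace ℝ (Fin 3) → EuclideanSpace ℝ (Fin 3)) (p : ℝ → EuclideanSpace ℝ (Fin 3) → ℝ),
      TaoFrame T' u p → u 0 = u₀ →
      (∀ t ∈ Set.Icc 0 T', ∀ x, ‖u t x - V t x‖ ≤ 2) →
      (∀ t ∈ Set.Icc 0 T', ∀ x, ‖u t x - V t x‖ ≤ K * ε ^ (-κ) * η) ∧
      (∀ β b : ℝ, 0 ≤ β → 0 ≤ b → K * ε ^ (-κ) * η ≤ 1 →
        eLpNorm (fun x => u₀ x - V 0 x) 3 volume ≤ ENNReal.ofReal β →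
        (∀ t ∈ Set.Icc 0 (1 - ε), eLpNorm (mildDefect V t) 3 volume ≤ ENNReal.ofReal β) →
        (∀ t ∈ Set.Icc 0 (1 - ε), eLpNorm (V t) 3 volume ≤ ENNReal.ofReal b) →
        ∀ t ∈ Set.Icc 0 T', eLpNorm (fun x => u t x - V t x) 3 volume ≤
          ENNReal.ofReal (K * (β + b * (K * ε ^ (-κ) * η))))

/-- Registered closed form of (QP1). [line object of `Cruxes/TypeIQuantSubcubicExp/Lines/quiet_collar.lean` v1.1 (ns-idea-7 g9), verbatim] -/
def StubQuietCollar : Prop :=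
  ∀ (M : ℝ) (v : ℝ → EuclideanSpace ℝ (Fin 3) → EuclideanSpace ℝ (Fin 3)),
    IsTypeIAncientMild M v → EnvelopeCubeBudget v → QuietCollar v

/-- Registered closed form of (QP2). [line object of `Cruxes/TypeIQuantSubcubicExp/Lines/quiet_collar.lean` v1.1 (ns-idea-7 g9), verbatim] -/
def StubCutPair : Prop :=
  ∀ (M : ℝ) (v : ℝ → EuclideanSpace ℝ (Fin 3) → EuclideanSpace ℝ (Fin 3)),
    IsTypeIAncientMild M v → EnvelopeCubeBudget v → CutPair v

/-- Registered closed form of (QP3) (it is already closed). [line object of `Cruxes/TypeIQuantSubcubicExp/Lines/quiet_collar.lean` v1.1 (ns-idea-7 g9), verbatim] -/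
def StubForcedTwoNormShadowing : Prop := ForcedTwoNormShadowing

end Summit.NavierStokesRegularity.NavierStokesRegularity.Cruxes.TypeIQuantSubcubicExp.QuietCollar

end
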